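import Literature.Probability.Percolation.InequalitiesProofs
import Literature.Probability.Percolation.PercolationProofs
import HarnessLib

/-!
# Chaining through a relay set: the Harris (FKG) bound and the contact number

Solo-blind generation 6, `PercolationContinuityZ3` (target `θ(p_c) = 0` on `ℤ³`).

Kozma–Nitzan (arXiv:2401.12397, Conjecture 3 and Theorem 6) reduce `θ(p_c) = 0` to a
"chaining" inequality: on a finite weighted graph, if `o ↔ A` with high probability and every
`a ∈ A` satisfies `a ↔ b` with high probability, then `o ↔ b` with high probability, UNIFORMLY in
the graph. This file records, kernel-checked and for Bernoulli bond percolation at any uniform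
density `p` on an ARBITRARY simple graph, exactly how much of that statement is free from
Harris's inequality alone, and identifies the residual quantity — the CONTACT NUMBER
`|C(o) ∩ A|` restricted to the good event `{o ↔ b}`:

* `harris_upper_lower` — mixed Harris: `P(U ∩ D) ≤ P(U) P(D)` for `U` increasing, `D` decreasing.
* `chaining_union_bound` — `P(o ↮ b) ≤ P(o ↮ A) + Σ_{a ∈ A} P(o ↔ a) · P(a ↮ b)`; hence the
  Kozma–Nitzan conclusion holds trivially whenever `δ · E|C(o) ∩ A| ≤ ε` (in particular when
  `δ |A| ≤ ε`): the content of their Conjecture 3 is the regime `|A| ≫ 1/δ`.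
* `chaining_contact_bound` — the refined form
  `(1 - δ) · Σ_a P(o ↔ a, o ↮ b) ≤ δ · Σ_a P(o ↔ a, o ↔ b)`, i.e. the bad event
  `{o ↔ A} \ {o ↔ b}` (which is contained in the left sum) is controlled by `δ/(1-δ)` times the
  expected contact number ON THE GOOD EVENT, `E[|C(o) ∩ A| ; o ↔ b]`.
* `chaining_bad_le_contact` — the packaged consequence
  `P({o ↔ A} \ {o ↔ b}) ≤ δ/(1-δ) · Σ_a P(o ↔ a, o ↔ b)`.

Reading (the wall document of this seat, §10): in the Kozma–Nitzan geometry `A` is the set of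
good frozen-shell classes of a level surface and on `{o ↔ T}` the cluster of `o` is the giant,
which meets a positive fraction of them, so the right-hand side is of order `δ |A| ⋙ 1`; the
inequality closes without any conjecture exactly when the number of contacts is concentrated
(`E[#contacts ; good] ≤ C ·` the number needed for one seed), which at the same `p` is one-sided
boundary touch density, i.e. half-space percolation — the same missing input as in the static
renormalisation. Nothing here is specific to `ℤ³`; the file is the graph-general FKG skeleton.

References: T. E. Harris, Proc. Camb. Phil. Soc. 56 (1960) (via the tree's `harris_fkg_holds`);
G. Kozma, S. Nitzan, arXiv:2401.12397 (2024), Conjecture 3, Lemma 10 Step V (context only).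
-/

namespace Summit.CriticalPhenomena.PercolationContinuityZ3.Theorems

open MeasureTheory Literature.Probability.Percolation Literature.Probability.LatticeModels

variable {V : Type*}

/-- **Mixed Harris inequality.** Under Bernoulli bond percolation `P_p` on any simple graph, an
increasing measurable event `U` and a decreasing measurable event `D` are negatively correlated:
`P_p(U ∩ D) ≤ P_p(U) · P_p(D)`. Proof: Harris for the increasing events `U`, `Dᶜ` gives
`P(U) P(Dᶜ) ≤ P(U ∩ Dᶜ)`, and `P(U ∩ D) = P(U) - P(U ∩ Dᶜ)`, `P(Dᶜ) = 1 - P(D)`. -/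
theorem harris_upper_lower (G : SimpleGraph V) (p : unitInterval) {U D : Set (BondConfig V)}
    (hU : IsUpperSet U) (hD : IsLowerSet D) (hUm : MeasurableSet U) (hDm : MeasurableSet D) :
    (bondPercolation G p).real (U ∩ D) ≤
      (bondPercolation G p).real U * (bondPercolation G p).real D := by
  have h := harris_fkg_holds G p hU hD.compl hUm hDm.compl
  have hsplit : (bondPercolation G p).real (U ∩ D) + (bondPercolation G p).real (U \ D) =
      (bondPercolation G p).real U := measureReal_inter_add_sdiff hDm (measure_ne_top _ _)
  rw [Set.sdiff_eq] at hsplit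
  rw [probReal_compl_eq_one_sub hDm] at h
  have hU1 : (bondPercolation G p).real U ≤ 1 := measureReal_le_one
  nlinarith [hsplit, h, hU1, measureReal_nonneg (μ := bondPercolation G p) (s := D)]

/-- Transitivity of open connection: `o ↔ a` and `a ↔ b` give `o ↔ b`. -/
theorem mem_openConn_trans {ω : BondConfig V} {o a b : V} (h₁ : ω ∈ openConn o a)
    (h₂ : ω ∈ openConn a b) : ω ∈ openConn o b :=
  SimpleGraph.Reachable.trans h₁ h₂

/-- Symmetry of open connection: `x ↔ y` iff `y ↔ x` (as membership). -/
theorem mem_openConn_symm {ω : BondConfig V} {x y : V} (h : ω ∈ openConn x y) :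
    ω ∈ openConn y x :=
  SimpleGraph.Reachable.symm h

/-- **The chaining decomposition of the bad event.** If `o ↮ b` then either `o` reaches no
vertex of the relay set `A`, or it reaches some `a ∈ A` which is itself cut from `b`:
`{o ↮ b} ⊆ {o ↮ A} ∪ ⋃_{a ∈ A} ({o ↔ a} ∩ {a ↮ b})`. -/
theorem compl_openConn_subset (o b : V) (A : Finset V) :
    (openConn o b : Set (BondConfig V))ᶜ ⊆
      (⋃ a ∈ A, (openConn o a : Set (BondConfig V)))ᶜ ∪
        ⋃ a ∈ A, ((openConn o a : Set (BondConfig V)) ∩ (openConn a b)ᶜ) := by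
  intro ω hω
  by_cases hA : ω ∈ ⋃ a ∈ A, (openConn o a : Set (BondConfig V))
  · right
    simp only [Set.mem_iUnion] at hA ⊢
    obtain ⟨a, haA, ha⟩ := hA
    refine ⟨a, haA, ha, ?_⟩
    intro hab
    exact hω (mem_openConn_trans ha hab)
  · left
    exact hA

/-- **On `{o ↔ a}`, the events `{o ↮ b}` and `{a ↮ b}` coincide**:
`{o ↔ a} ∩ {o ↮ b} = {o ↔ a} ∩ {a ↮ b}` (transitivity and symmetry of `↔`). -/
theorem openConn_inter_compl_eq (o a b : V) :
    (openConn o a : Set (BondConfig V)) ∩ (openConn o b)ᶜ =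
      (openConn o a : Set (BondConfig V)) ∩ (openConn a b)ᶜ := by
  ext ω
  simp only [Set.mem_inter_iff, Set.mem_compl_iff]
  constructor
  · rintro ⟨hoa, hob⟩
    exact ⟨hoa, fun hab => hob (mem_openConn_trans hoa hab)⟩
  · rintro ⟨hoa, hab⟩
    exact ⟨hoa, fun hob => hab (mem_openConn_trans (mem_openConn_symm hoa) hob)⟩

variable [Countable V]

/-- **Chaining union bound (Harris only).** For Bernoulli bond percolation at any density `p` on
any simple graph with countably many vertices, any two vertices `o, b` and any finite relay set
`A`:
`P_p(o ↮ b) ≤ P_p(o ↮ A) + Σ_{a ∈ A} P_p(o ↔ a) · P_p(a ↮ b)`,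
where `{o ↮ A}` is the complement of `⋃_{a ∈ A} {o ↔ a}`. In particular, if `P_p(a ↮ b) ≤ δ` for
every `a ∈ A` then `P_p(o ↮ b) ≤ P_p(o ↮ A) + δ · E_p|C(o) ∩ A|`: the Kozma–Nitzan chaining
conclusion is free whenever the expected contact number is `O(1)`; the content of their
Conjecture 3 lies entirely in the regime `E|C(o) ∩ A| ≫ 1/δ`. Proof: `compl_openConn_subset`,
the union bound, and the mixed Harris inequality `harris_upper_lower` for the increasing event
`{o ↔ a}` and the decreasing event `{a ↮ b}`. -/
theorem chaining_union_bound (G : SimpleGraph V) (p : unitInterval) (o b : V) (A : Finset V) :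
    (bondPercolation G p).real (openConn o b : Set (BondConfig V))ᶜ ≤
      (bondPercolation G p).real (⋃ a ∈ A, (openConn o a : Set (BondConfig V)))ᶜ +
        ∑ a ∈ A, (bondPercolation G p).real (openConn o a) *
          (bondPercolation G p).real (openConn a b : Set (BondConfig V))ᶜ := by
  set μ := bondPercolation G p with hμ
  calc μ.real (openConn o b : Set (BondConfig V))ᶜ
      ≤ μ.real ((⋃ a ∈ A, (openConn o a : Set (BondConfig V)))ᶜ ∪
          ⋃ a ∈ A, ((openConn o a : Set (BondConfig V)) ∩ (openConn a b)ᶜ)) :=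
        measureReal_mono (compl_openConn_subset o b A) (measure_ne_top _ _)
    _ ≤ μ.real (⋃ a ∈ A, (openConn o a : Set (BondConfig V)))ᶜ +
          μ.real (⋃ a ∈ A, ((openConn o a : Set (BondConfig V)) ∩ (openConn a b)ᶜ)) :=
        measureReal_union_le _ _
    _ ≤ μ.real (⋃ a ∈ A, (openConn o a : Set (BondConfig V)))ᶜ +
          ∑ a ∈ A, μ.real ((openConn o a : Set (BondConfig V)) ∩ (openConn a b)ᶜ) := by
        gcongr
        exact measureReal_biUnion_finset_le _ _
    _ ≤ μ.real (⋃ a ∈ A, (openConn o a : Set (BondConfig V)))ᶜ +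
          ∑ a ∈ A, μ.real (openConn o a) * μ.real (openConn a b : Set (BondConfig V))ᶜ := by
        gcongr with a ha
        exact harris_upper_lower G p (isUpperSet_openConn o a) (isUpperSet_openConn a b).compl
          (measurableSet_openConn_holds o a) (measurableSet_openConn_holds a b).compl

/-- **Kozma–Nitzan Conjecture 3 in the small-contact regime (unconditional).** If
`P_p(o ↔ A) ≥ 1 - δ₁` and `P_p(a ↮ b) ≤ δ` for all `a ∈ A`, then
`P_p(o ↔ b) ≥ 1 - δ₁ - δ · Σ_{a ∈ A} P_p(o ↔ a)`; the last sum is `E_p|C(o) ∩ A| ≤ |A|`. -/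
theorem chaining_small_contact (G : SimpleGraph V) (p : unitInterval) (o b : V) (A : Finset V)
    {δ δ₁ : ℝ} (hA : 1 - δ₁ ≤ (bondPercolation G p).real (⋃ a ∈ A, (openConn o a : Set (BondConfig V))))
    (hδ : ∀ a ∈ A, (bondPercolation G p).real (openConn a b : Set (BondConfig V))ᶜ ≤ δ) :
    1 - δ₁ - δ * ∑ a ∈ A, (bondPercolation G p).real (openConn o a : Set (BondConfig V)) ≤
      (bondPercolation G p).real (openConn o b : Set (BondConfig V)) := by
  set μ := bondPercolation G p with hμ
  have hmeasU : MeasurableSet (⋃ a ∈ A, (openConn o a : Set (BondConfig V))) :=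
    Finset.measurableSet_biUnion A fun a _ => measurableSet_openConn_holds o a
  have h := chaining_union_bound G p o b A
  rw [probReal_compl_eq_one_sub (measurableSet_openConn_holds o b),
    probReal_compl_eq_one_sub hmeasU] at h
  have hsum : ∑ a ∈ A, μ.real (openConn o a) * μ.real (openConn a b : Set (BondConfig V))ᶜ ≤
      δ * ∑ a ∈ A, μ.real (openConn o a : Set (BondConfig V)) := by
    rw [Finset.mul_sum]
    refine Finset.sum_le_sum fun a ha => ?_
    rw [mul_comm δ]
    exact mul_le_mul_of_nonneg_left (hδ a ha) measureReal_nonneg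
  linarith

/-- **Refined chaining bound: the bad event is paid for by contacts on the GOOD event.** If
`P_p(a ↮ b) ≤ δ` for every `a ∈ A`, then
`(1 - δ) · Σ_{a ∈ A} P_p(o ↔ a, o ↮ b) ≤ δ · Σ_{a ∈ A} P_p(o ↔ a, o ↔ b)`.
The left sum is `E_p[|C(o) ∩ A| ; o ↮ b] ≥ P_p({o ↔ A} \ {o ↔ b})`; the right sum is
`E_p[|C(o) ∩ A| ; o ↔ b]`. Proof: on `{o ↔ a}` the events `{o ↮ b}` and `{a ↮ b}` coincide
(`openConn_inter_compl_eq`), mixed Harris gives `P(o ↔ a, a ↮ b) ≤ δ P(o ↔ a)`, and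
`P(o ↔ a) = P(o ↔ a, o ↔ b) + P(o ↔ a, o ↮ b)`. -/
theorem chaining_contact_bound (G : SimpleGraph V) (p : unitInterval) (o b : V) (A : Finset V)
    {δ : ℝ} (hδ : ∀ a ∈ A, (bondPercolation G p).real (openConn a b : Set (BondConfig V))ᶜ ≤ δ) :
    (1 - δ) * ∑ a ∈ A, (bondPercolation G p).real
        ((openConn o a : Set (BondConfig V)) ∩ (openConn o b)ᶜ) ≤
      δ * ∑ a ∈ A, (bondPercolation G p).real
        ((openConn o a : Set (BondConfig V)) ∩ openConn o b) := by
  set μ := bondPercolation G p with hμ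
  have hterm : ∀ a ∈ A,
      (1 - δ) * μ.real ((openConn o a : Set (BondConfig V)) ∩ (openConn o b)ᶜ) ≤
        δ * μ.real ((openConn o a : Set (BondConfig V)) ∩ openConn o b) := by
    intro a ha
    have hsplit : μ.real ((openConn o a : Set (BondConfig V)) ∩ openConn o b) +
        μ.real ((openConn o a : Set (BondConfig V)) \ openConn o b) = μ.real (openConn o a) :=
      measureReal_inter_add_sdiff (measurableSet_openConn_holds o b) (measure_ne_top _ _)
    rw [Set.sdiff_eq] at hsplit
    have hH : μ.real ((openConn o a : Set (BondConfig V)) ∩ (openConn o b)ᶜ) ≤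
        μ.real (openConn o a) * δ := by
      rw [openConn_inter_compl_eq]
      calc μ.real ((openConn o a : Set (BondConfig V)) ∩ (openConn a b)ᶜ)
          ≤ μ.real (openConn o a) * μ.real (openConn a b : Set (BondConfig V))ᶜ :=
            harris_upper_lower G p (isUpperSet_openConn o a) (isUpperSet_openConn a b).compl
              (measurableSet_openConn_holds o a) (measurableSet_openConn_holds a b).compl
        _ ≤ μ.real (openConn o a) * δ :=
            mul_le_mul_of_nonneg_left (hδ a ha) measureReal_nonneg
    have key : μ.real ((openConn o a : Set (BondConfig V)) ∩ (openConn o b)ᶜ) ≤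
        δ * μ.real ((openConn o a : Set (BondConfig V)) ∩ openConn o b) +
          δ * μ.real ((openConn o a : Set (BondConfig V)) ∩ (openConn o b)ᶜ) := by
      calc μ.real ((openConn o a : Set (BondConfig V)) ∩ (openConn o b)ᶜ)
          ≤ μ.real (openConn o a) * δ := hH
        _ = δ * μ.real ((openConn o a : Set (BondConfig V)) ∩ openConn o b) +
              δ * μ.real ((openConn o a : Set (BondConfig V)) ∩ (openConn o b)ᶜ) := by
            rw [← hsplit]; ring
    linarith [key]
  rw [Finset.mul_sum, Finset.mul_sum]
  exact Finset.sum_le_sum hterm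

omit [Countable V] in
/-- **The bad event is at most the bad contact number.**
`P_p({o ↔ A} \ {o ↔ b}) ≤ Σ_{a ∈ A} P_p(o ↔ a, o ↮ b) = E_p[|C(o) ∩ A| ; o ↮ b]` (union bound). -/
theorem bad_le_sum_contact (G : SimpleGraph V) (p : unitInterval) (o b : V) (A : Finset V) :
    (bondPercolation G p).real ((⋃ a ∈ A, (openConn o a : Set (BondConfig V))) \ openConn o b) ≤
      ∑ a ∈ A, (bondPercolation G p).real
        ((openConn o a : Set (BondConfig V)) ∩ (openConn o b)ᶜ) := by
  have hsub : (⋃ a ∈ A, (openConn o a : Set (BondConfig V))) \ openConn o b ⊆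
      ⋃ a ∈ A, ((openConn o a : Set (BondConfig V)) ∩ (openConn o b)ᶜ) := by
    intro ω hω
    simp only [Set.mem_sdiff, Set.mem_iUnion] at hω
    obtain ⟨⟨a, haA, ha⟩, hob⟩ := hω
    simp only [Set.mem_iUnion]
    exact ⟨a, haA, ha, hob⟩
  exact (measureReal_mono hsub (measure_ne_top _ _)).trans (measureReal_biUnion_finset_le _ _)

/-- **Packaged consequence: bad chaining costs `δ/(1-δ)` per good contact.** If `δ < 1` and
`P_p(a ↮ b) ≤ δ` for all `a ∈ A`, then
`P_p({o ↔ A} \ {o ↔ b}) ≤ δ/(1-δ) · Σ_{a ∈ A} P_p(o ↔ a, o ↔ b) = δ/(1-δ) · E_p[|C(o) ∩ A| ; o ↔ b]`.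
This is the precise sense in which the only input beyond Harris's inequality that a
Kozma–Nitzan-type chaining needs is control of the number of relay contacts on the good event. -/
theorem chaining_bad_le_contact (G : SimpleGraph V) (p : unitInterval) (o b : V) (A : Finset V)
    {δ : ℝ} (hδ1 : δ < 1)
    (hδ : ∀ a ∈ A, (bondPercolation G p).real (openConn a b : Set (BondConfig V))ᶜ ≤ δ) :
    (bondPercolation G p).real ((⋃ a ∈ A, (openConn o a : Set (BondConfig V))) \ openConn o b) ≤
      δ / (1 - δ) * ∑ a ∈ A, (bondPercolation G p).real
        ((openConn o a : Set (BondConfig V)) ∩ openConn o b) := by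
  have h1 := bad_le_sum_contact G p o b A
  have h2 := chaining_contact_bound G p o b A hδ
  have hpos : 0 < 1 - δ := by linarith
  rw [div_mul_eq_mul_div, le_div_iff₀ hpos]
  calc (bondPercolation G p).real ((⋃ a ∈ A, (openConn o a : Set (BondConfig V))) \ openConn o b) *
        (1 - δ)
      ≤ (∑ a ∈ A, (bondPercolation G p).real
          ((openConn o a : Set (BondConfig V)) ∩ (openConn o b)ᶜ)) * (1 - δ) :=
        mul_le_mul_of_nonneg_right h1 hpos.le
    _ ≤ δ * ∑ a ∈ A, (bondPercolation G p).real
          ((openConn o a : Set (BondConfig V)) ∩ openConn o b) := by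
        rw [mul_comm]; exact h2

end Summit.CriticalPhenomena.PercolationContinuityZ3.Theorems
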